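import Literature.NumberTheory.LFunctions.Zhang2022.RepairIntakeBlen
import Literature.NumberTheory.LFunctions.Zhang2022.RepairIntakeBmultiMembers
import Literature.NumberTheory.LFunctions.Zhang2022.KnifeEdgeThreshold

/-!
# Zhang (2022), repair rung F-S3 §E KILL-INTAKE of B-len (S-E-t2-2): the (L-a) members of `𝒟_len` as terms of
# `Repair.BlenDesign`, with their memberships PROVED

Y. Zhang, *Discrete mean estimates and the Landau–Siegel zero*, arXiv:2211.02515v1 [Zhang2022LandauSiegel] — an
unrefereed manuscript under adjudication; NOTHING here asserts any of its claims and nothing here is a statement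
about Landau–Siegel zeros. Cell `landau-siegel`, §E KILL-INTAKE of family B-len (intake file `RepairIntakeBlen.lean`,
p465008: the union design type `Repair.BlenDesign`, membership `KBlen`, verdict `VBlen`, `familyBlen_decided`); this is
the B-len twin of `RepairIntakeBmultiMembers.lean` (p465350). PURE GLUE: for the (L-a) strata of
`B-len/DESIGN-MAP-len.md` v0.8 (466a1df1b6d1231c; §S0 scan `designs-scan1.json` + §S2/§S3 rows) each member is a
term of `BlenDesign` — the constructor of its stratum carrying the design's LITERAL profile data in the tree's
vocabulary — and its membership `KBlen` is PROVED; verdicts follow by `familyBlen_decided` (nothing re-proved).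

| stratum (rows) | member term | data | membership |
|---|---|---|---|
| S1 `len-S1-kappa-thθ-kk` (27: θ ∈ {101/100,…,2}, k ∈ {3/2,5/2,7/2}) | `member_S1 θ k = .s1wall ϰ(θ,k) ϰ′(θ,k) (flat ϰ_{θ,k}(1))` (literal-plateau reading: Zhang's long piece as the discrete mean sees it; the far part beyond the band is THEOREM E-033) | `Repair.kappaP θ k` | `kblen_S1` (`1 < θ`), `kblen_S1_grid` |
| S2 `len-S2-kappa1kk+phi-thθ` (10) | `member_S2kappa k θ s = .s2 θ ϰ(1,k) ϰ′(1,k) φ_θ φ_θ′ s` | `kappaP 1 k`, `phiT θ` | `kblen_S2kappa` (`1 ≤ θ`) |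
| S2 `len-S2-hat+phi-thθ` (5) | `member_S2hat θ s = .s2 θ hat hat′ φ_θ φ_θ′ s` | NEW `hatP = 2(ϰ(1,0) − ϰ(1/2,0))` (the tent `[0,1/2,1]`), `inClassPiece_hatP` | `kblen_S2hat` |
| S2 `…+phitw5:2…` (15, twisted bump `φ_θ(z)e^{iπ(5/2)(θ−z)}`) | NEW `phiTw θ k` with `overhangPiece_phiTw`; `member_S2kappaTw`, `member_S2hatTw` | | `kblen_S2kappaTw`, `kblen_S2hatTw` |
| S3a `len-S3a-sharptop-thθ` (4: `ϰ(1,5/2) ⊕ (z−1)e^{iπ(5/2)(θ−z)}𝟙_{[1,θ)}`, sharp top) | `member_S3a θ s = .s2rough θ ϰ(1,5/2) … (sharpRamp θ (5/2)) …` | NEW generic `roughOverhangPiece_indicator` + `sharpRamp` | `kblen_S3a` |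
| S3b `len-S3b-walljump-thθ` (4: `ϰ(θ,5/2)∣[0,1]`, jump `ϰ(1) → ϰ(1)/2` at the wall, half continuation) | `member_S3b θ = .s1wall ϰ(θ,5/2) ϰ′ (flat (ϰ_{θ,5/2}(1)/2))` (`kblen_wallJump` shape; the O(1)-scale continuation is far = E-033) | | `kblen_S3b` |
| S3c `len-S3c-flat-thθ` (4: `ϰ(1,5/2) ⊕ e^{iπ(5/2)(θ−z)}𝟙_{[1,θ)}`) | `member_S3c θ s = .s2rough θ ϰ(1,5/2) … (twistPlateau θ (5/2)) …` and the band reading `member_S3cWall = .s1wall ϰ(1,5/2) … (flat 1)` | NEW `twistPlateau` | `kblen_S3c`, `kblen_S3cWall` |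
| S3 far / far-BV (multi-far-001 lengths) | `member_S3far c'`, `member_S3farBV c'` (p4's `farStep` / `farBlock`) | | `kblen_S3far…` |
| θ-box / in-print | `member_thetaBox = .thetaBox θ₀`, `member_inPrint = .inPrint θ₀` | `theta0` | `kblen_thetaBox`, `kblen_inPrint` |

NOT covered here (no `BlenDesign` constructor at v1; typed by the B-len typers' (L-b)/(L-c) family files): the
`len-nu-*` (ν = 1∗χ), `len-lam-*` (Λ-type overhang) and `len-mu-*` rows of DESIGN-MAP-len §S4–§S6. Readings declared:
amplitudes/`ι` enter at `ι ≡ 1` / free scalar `s`; S1/S3b band data in the BALANCED reading of `familyWallBand`; the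
DESIGN-MAP one-line dumps print the S1 twist as `e^{iπ·0z}` while naming `k` — we use `ϰ(θ,k)` with the named `k`.
[cite: Zhang2022LandauSiegel, (2.23)–(2.25), §2 (2.32)–(2.33), §7 Prop 7.1 (7.2)]
«The programme SEARCHES and TYPES; no claim about Landau–Siegel zeros, Theorems 1–2 of arXiv:2211.02515 or a
repaired Margin232 until a kernel theorem says so.»
-/

noncomputable section

open Complex Real Set
open _root_.MeasureTheory

namespace Literature.NumberTheory.LFunctions.Zhang2022

namespace Repair

open KnifeEdge

/-! ### Part 0 — profile lemmas: the tent, the twisted bump, rough indicator overhangs -/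

section Profiles

variable {θ k : ℝ}

/-- **The tent profile `hat[0,1/2,1]`** (`2z` on `[0,1/2]`, `2 − 2z` on `[1/2,1]`, `0` beyond `1`) written in the
`ϰ`-basis: `2(ϰ_{1,0} − ϰ_{1/2,0})`. [cite: Zhang2022LandauSiegel, (2.23)–(2.25)] -/
def hatP (y : ℝ) : ℂ := 2 * kappaP 1 0 y + (-2) * kappaP (1 / 2) 0 y

/-- its marked right derivative. [cite: Zhang2022LandauSiegel, (2.23)–(2.25)] -/
def hatP' (y : ℝ) : ℂ := 2 * kappaP' 1 0 y + (-2) * kappaP' (1 / 2) 0 y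

/-- The tent is the literal hat on `[0, ∞)`: `2y` on `[0,1/2]`, `2 − 2y` on `[1/2,1]`, `0` on `[1,∞)`.
[cite: Zhang2022LandauSiegel, (2.23)–(2.25)] -/
theorem hatP_eq {y : ℝ} :
    (y ≤ 1 / 2 → hatP y = ((2 * y : ℝ) : ℂ)) ∧ (1 / 2 < y → y ≤ 1 → hatP y = ((2 - 2 * y : ℝ) : ℂ)) ∧
      (1 < y → hatP y = 0) := by
  refine ⟨fun h => ?_, fun h1 h2 => ?_, fun h => ?_⟩
  · have h1 : y ≤ 1 := by linarith
    rw [hatP, kappaP_of_le h1, kappaP_of_le h]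
    simp only [Complex.ofReal_zero, zero_mul, Complex.exp_zero, mul_one]
    push_cast; ring
  · rw [hatP, kappaP_of_le h2, kappaP_of_lt h1]
    simp only [Complex.ofReal_zero, zero_mul, Complex.exp_zero, mul_one, mul_zero, add_zero]
    push_cast; ring
  · rw [hatP, kappaP_of_lt h, kappaP_of_lt (by linarith)]; ring

/-- The tent is an in-class piece. [cite: Zhang2022LandauSiegel, (2.23)–(2.25); §7 Prop 7.1 (7.2)] -/
theorem inClassPiece_hatP : InClassPiece hatP hatP' where
  kinked := by
    have h1 := (kinkedProfile_kappaP (k := 0) (ν := 1) (by norm_num) le_rfl).smul 2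
    have h2 := kinkedProfile_kappaP (k := 0) (ν := 1 / 2) (by norm_num) (by norm_num)
    exact h1.add_smul h2 (-2)
  vanish := fun y hy => by
    rw [hatP, kappaP_of_ge one_ne_zero hy, kappaP_of_ge (by norm_num) (by linarith)]; ring
  vanish' := fun y hy => by
    rw [hatP', kappaP'_of_ge hy, kappaP'_of_ge (by linarith)]; ring

/-- The twist factor `e^{iπk(θ−y)}` (modulus `1`). [cite: Zhang2022LandauSiegel, (2.23)–(2.25)] -/
def twist (θ k : ℝ) (y : ℝ) : ℂ := cexp (((k * π * (θ - y) : ℝ) : ℂ) * I)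

/-- its derivative `−iπk·e^{iπk(θ−y)}`. [cite: Zhang2022LandauSiegel, (2.23)–(2.25)] -/
def twist' (θ k : ℝ) (y : ℝ) : ℂ := cexp (((k * π * (θ - y) : ℝ) : ℂ) * I) * ((((-(k * π)) : ℝ) : ℂ) * I)

/-- `‖twist‖ = 1`. [cite: Zhang2022LandauSiegel, (2.23)–(2.25)] -/
theorem norm_twist (θ k y : ℝ) : ‖twist θ k y‖ = 1 := by
  rw [twist, Complex.norm_exp_ofReal_mul_I]

/-- `‖twist′‖ = |k|π`. [cite: Zhang2022LandauSiegel, (2.23)–(2.25)] -/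
theorem norm_twist' (θ k y : ℝ) : ‖twist' θ k y‖ = |k| * π := by
  rw [twist', norm_mul, Complex.norm_exp_ofReal_mul_I, one_mul, norm_mul, Complex.norm_I, mul_one,
    Complex.norm_real, Real.norm_eq_abs, abs_neg, abs_mul, abs_of_pos Real.pi_pos]

/-- continuity of the twist. [cite: Zhang2022LandauSiegel, (2.23)–(2.25)] -/
theorem continuous_twist (θ k : ℝ) : Continuous (twist θ k) := by unfold twist; fun_prop

/-- continuity of its derivative. [cite: Zhang2022LandauSiegel, (2.23)–(2.25)] -/
theorem continuous_twist' (θ k : ℝ) : Continuous (twist' θ k) := by unfold twist'; fun_prop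

/-- derivative of the twist. [cite: Zhang2022LandauSiegel, (2.23)–(2.25)] -/
theorem hasDerivAt_twist (θ k y : ℝ) : HasDerivAt (twist θ k) (twist' θ k y) y := by
  have h1 : HasDerivAt (fun x : ℝ => ((k * π * (θ - x) : ℝ) : ℂ)) (((-(k * π)) : ℝ) : ℂ) y := by
    have hr : HasDerivAt (fun x : ℝ => k * π * (θ - x)) (-(k * π)) y := by
      simpa using ((hasDerivAt_id y).const_sub θ).const_mul (k * π)
    exact hr.ofReal_comp
  have h2 := (h1.mul_const I).cexp
  unfold twist twist'
  convert h2 using 1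

/-- **The twisted bump `φ_θ(y)e^{iπk(θ−y)}`** (rows `…+phitwk-thθ`). [cite: Zhang2022LandauSiegel, (2.23)–(2.25); §7 (7.2)] -/
def phiTw (θ k : ℝ) (y : ℝ) : ℂ := phiT θ y * twist θ k y

/-- its marked right derivative. [cite: Zhang2022LandauSiegel, (2.23)–(2.25)] -/
def phiTw' (θ k : ℝ) (y : ℝ) : ℂ := phiT' θ y * twist θ k y + phiT θ y * twist' θ k y

/-- The twisted bump is an overhang piece of length `θ` (`1 ≤ θ`). [cite: Zhang2022LandauSiegel, §7 Prop 7.1 (7.2)] -/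
theorem overhangPiece_phiTw (hθ : 1 ≤ θ) (k : ℝ) : OverhangPiece θ (phiTw θ k) (phiTw' θ k) where
  cont := ((continuous_phiT θ).mul (continuous_twist θ k)).continuousOn
  hasDeriv := fun x hx =>
    ((overhangPiece_phiT hθ).hasDeriv x hx).mul (hasDerivAt_twist θ k x).hasDerivWithinAt
  memLp := by
    -- both summands are bounded and measurable on `(1, θ]`
    have hm1 : Measurable (phiT' θ) := by
      have e : phiT' θ = fun y => if 1 ≤ y then (((θ + 1 - 2 * y) : ℝ) : ℂ) else 0 := rfl
      rw [e]
      exact Measurable.ite measurableSet_Ici (Complex.continuous_ofReal.comp (by fun_prop)).measurable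
        measurable_const
    have h1 : MemLp (fun y => phiT' θ y * twist θ k y) 2 (volume.restrict (Ioc 1 θ)) := by
      refine MemLp.of_bound ((hm1.mul (continuous_twist θ k).measurable).aestronglyMeasurable)
        (|θ + 1| + 2 * |θ|) ?_
      refine (ae_restrict_iff' measurableSet_Ioc).2 (ae_of_all _ fun y hy => ?_)
      rw [norm_mul, norm_twist, mul_one, phiT'_of_ge hy.1.le, Complex.norm_real, Real.norm_eq_abs]
      calc |θ + 1 - 2 * y| ≤ |θ + 1| + |2 * y| := abs_sub _ _
        _ = |θ + 1| + 2 * |y| := by rw [abs_mul, abs_two]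
        _ ≤ |θ + 1| + 2 * |θ| := by
            have : |y| ≤ |θ| := by rw [abs_of_pos (by linarith [hy.1]), abs_of_pos (by linarith [hy.1, hy.2])]; exact hy.2
            linarith
    have h2 : MemLp (fun y => phiT θ y * twist' θ k y) 2 (volume.restrict (Ioc 1 θ)) := by
      have hc : Continuous fun y => phiT θ y * twist' θ k y := (continuous_phiT θ).mul (continuous_twist' θ k)
      have hb : ∀ y ∈ Icc (1:ℝ) θ, ‖phiT θ y * twist' θ k y‖ ≤ (θ - 1) * (θ - 1) * (|k| * π) := by
        intro y hy
        rw [norm_mul, norm_twist']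
        refine mul_le_mul_of_nonneg_right ?_ (by positivity)
        rw [phiT, Complex.norm_real, Real.norm_eq_abs, max_eq_left hy.1, abs_mul, abs_of_nonneg (by linarith [hy.1]),
          abs_of_nonneg (by linarith [hy.2])]
        exact mul_le_mul (by linarith [hy.2]) (by linarith [hy.1]) (by linarith [hy.2]) (by linarith [hy.2])
      refine MemLp.of_bound hc.aestronglyMeasurable ((θ - 1) * (θ - 1) * (|k| * π)) ?_
      exact (ae_restrict_iff' measurableSet_Ioc).2 (ae_of_all _ fun y hy => hb y ⟨hy.1.le, hy.2⟩)
    exact h1.add h2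
  vanish := fun y hy => by rw [phiTw, (overhangPiece_phiT hθ).vanish y hy, zero_mul]
  vanish' := fun y hy => by
    rw [phiTw', (overhangPiece_phiT hθ).vanish' y hy, (overhangPiece_phiT hθ).vanish y hy.le, zero_mul, zero_mul,
      add_zero]
  top := by rw [phiTw, (overhangPiece_phiT hθ).top, zero_mul]

/-- **Rough indicator overhangs:** for `f` continuously differentiable on `ℝ`, the piece `f·𝟙_{[1,θ)}` (sharp at both
ends allowed) with marked derivative `f′·𝟙_{[1,θ)}` is a `RoughOverhangPiece θ` (exceptional set `∅`).
[cite: Zhang2022LandauSiegel, §7 Prop 7.1 (7.2)] -/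
theorem roughOverhangPiece_indicator {f f' : ℝ → ℂ} (hf : Continuous f) (hf' : Continuous f')
    (hd : ∀ y, HasDerivAt f (f' y) y) {B : ℝ} (hB : ∀ y ∈ Icc (1:ℝ) θ, ‖f y‖ ≤ B ∧ ‖f' y‖ ≤ B) :
    RoughOverhangPiece θ ((Ico 1 θ).indicator f) ((Ico 1 θ).indicator f') where
  memLp := by
    refine MemLp.of_bound ((hf.measurable.indicator measurableSet_Ico).aestronglyMeasurable) (max B 0) ?_
    refine (ae_restrict_iff' measurableSet_Ioc).2 (ae_of_all _ fun y hy => ?_)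
    by_cases hm : y ∈ Ico (1:ℝ) θ
    · rw [Set.indicator_of_mem hm]; exact ((hB y ⟨hm.1, hm.2.le⟩).1).trans (le_max_left _ _)
    · rw [Set.indicator_of_notMem hm, norm_zero]; exact le_max_right _ _
  memLp' := by
    refine MemLp.of_bound ((hf'.measurable.indicator measurableSet_Ico).aestronglyMeasurable) (max B 0) ?_
    refine (ae_restrict_iff' measurableSet_Ioc).2 (ae_of_all _ fun y hy => ?_)
    by_cases hm : y ∈ Ico (1:ℝ) θ
    · rw [Set.indicator_of_mem hm]; exact ((hB y ⟨hm.1, hm.2.le⟩).2).trans (le_max_left _ _)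
    · rw [Set.indicator_of_notMem hm, norm_zero]; exact le_max_right _ _
  pwDeriv := ⟨(∅ : Finset ℝ), fun x hx _ => by
    rw [Set.indicator_of_mem hx]
    have hev : (Ico 1 θ).indicator f =ᶠ[nhdsWithin x (Ioi x)] f := by
      have hmem : Ioo x θ ∈ nhdsWithin x (Ioi x) := Ioo_mem_nhdsGT hx.2
      filter_upwards [hmem] with y hy
      exact Set.indicator_of_mem (show y ∈ Ico 1 θ from ⟨hx.1.trans hy.1.le, hy.2⟩) _
    exact ((hd x).hasDerivWithinAt).congr_of_eventuallyEq hev (Set.indicator_of_mem hx _)⟩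
  vanish := fun y hy => Set.indicator_of_notMem (fun hm => not_le.2 hy hm.1) _
  vanish' := fun y hy => Set.indicator_of_notMem (fun hm => not_le.2 hy hm.1) _

/-- **The twisted sharp ramp** `(y−1)e^{iπk(θ−y)}𝟙_{[1,θ)}` (rows `len-S3a-sharptop`: value `θ−1 ≠ 0` just below the
top, `0` from `θ` on). [cite: Zhang2022LandauSiegel, §7 (7.2)] -/
def sharpRamp (θ k : ℝ) : ℝ → ℂ := (Ico 1 θ).indicator fun y => ((y - 1 : ℝ) : ℂ) * twist θ k y

/-- its marked right derivative. [cite: Zhang2022LandauSiegel, §7 (7.2)] -/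
def sharpRamp' (θ k : ℝ) : ℝ → ℂ :=
  (Ico 1 θ).indicator fun y => (1 : ℂ) * twist θ k y + ((y - 1 : ℝ) : ℂ) * twist' θ k y

/-- The twisted sharp ramp is a rough overhang piece. [cite: Zhang2022LandauSiegel, §7 Prop 7.1 (7.2)] -/
theorem roughOverhangPiece_sharpRamp (θ k : ℝ) : RoughOverhangPiece θ (sharpRamp θ k) (sharpRamp' θ k) := by
  have hlin : ∀ y : ℝ, HasDerivAt (fun x : ℝ => ((x - 1 : ℝ) : ℂ)) (1 : ℂ) y := fun y => by
    simpa using ((hasDerivAt_id y).sub_const (1:ℝ)).ofReal_comp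
  have hc1 : Continuous fun y : ℝ => ((y - 1 : ℝ) : ℂ) * twist θ k y :=
    (Complex.continuous_ofReal.comp (by fun_prop)).mul (continuous_twist θ k)
  have hc2 : Continuous fun y : ℝ => (1 : ℂ) * twist θ k y + ((y - 1 : ℝ) : ℂ) * twist' θ k y :=
    (continuous_const.mul (continuous_twist θ k)).add
      ((Complex.continuous_ofReal.comp (by fun_prop)).mul (continuous_twist' θ k))
  refine roughOverhangPiece_indicator (B := max (θ - 1) 0 * (1 + |k| * π) + 1) hc1 hc2
    (fun y => (hlin y).mul (hasDerivAt_twist θ k y)) fun y hy => ⟨?_, ?_⟩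
  · rw [norm_mul, norm_twist, mul_one, Complex.norm_real, Real.norm_eq_abs, abs_of_nonneg (by linarith [hy.1])]
    have h1 : y - 1 ≤ max (θ - 1) 0 := (le_max_left _ _).trans' (by linarith [hy.2])
    have h2 : 0 ≤ max (θ - 1) 0 * (|k| * π) := by positivity
    nlinarith [le_max_right (θ - 1) 0]
  · have e1 : ‖(1 : ℂ) * twist θ k y‖ = 1 := by rw [one_mul, norm_twist]
    have e2 : ‖((y - 1 : ℝ) : ℂ) * twist' θ k y‖ = (y - 1) * (|k| * π) := by
      rw [norm_mul, norm_twist', Complex.norm_real, Real.norm_eq_abs, abs_of_nonneg (by linarith [hy.1])]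
    refine (norm_add_le _ _).trans ?_
    rw [e1, e2]
    have h1 : y - 1 ≤ max (θ - 1) 0 := (le_max_left _ _).trans' (by linarith [hy.2])
    have h3 : 0 ≤ |k| * π := by positivity
    nlinarith [le_max_right (θ - 1) 0, mul_le_mul_of_nonneg_right h1 h3]

/-- **The twisted plateau** `e^{iπk(θ−y)}𝟙_{[1,θ)}` (rows `len-S3c-flat`). [cite: Zhang2022LandauSiegel, §7 (7.2)] -/
def twistPlateau (θ k : ℝ) : ℝ → ℂ := (Ico 1 θ).indicator (twist θ k)

/-- its marked right derivative. [cite: Zhang2022LandauSiegel, §7 (7.2)] -/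
def twistPlateau' (θ k : ℝ) : ℝ → ℂ := (Ico 1 θ).indicator (twist' θ k)

/-- The twisted plateau is a rough overhang piece. [cite: Zhang2022LandauSiegel, §7 Prop 7.1 (7.2)] -/
theorem roughOverhangPiece_twistPlateau (θ k : ℝ) :
    RoughOverhangPiece θ (twistPlateau θ k) (twistPlateau' θ k) :=
  roughOverhangPiece_indicator (B := 1 + |k| * π) (continuous_twist θ k) (continuous_twist' θ k)
    (hasDerivAt_twist θ k) fun y _ =>
    ⟨by rw [norm_twist]; linarith [show 0 ≤ |k| * π by positivity], by rw [norm_twist']; linarith⟩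

/-- At twist `0` the twisted plateau is p3's `plateau`. [cite: Zhang2022LandauSiegel, §7 (7.2)] -/
theorem twistPlateau_zero (θ : ℝ) : twistPlateau θ 0 = plateau θ := by
  funext y; unfold twistPlateau plateau twist; by_cases h : y ∈ Ico 1 θ <;> simp [h]

end Profiles

/-! ### Part 1 — S1: Zhang-length `ϰ`-pieces through the wall (27 rows) -/

/-- **`len-S1-kappa-thθ-kk`**: the long piece `ϰ(θ,k)` truncated at the wall, wall value `ϰ_{θ,k}(1) = 1 − 1/θ ≠ 0`
continued FLAT through the band (literal-plateau reading). [cite: Zhang2022LandauSiegel, (2.23)–(2.25); §2 (2.30)] -/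
def member_S1 (θ k : ℝ) : BlenDesign := .s1wall (kappaP θ k) (kappaP' θ k) (WallData.flat (kappaP θ k 1))

/-- … is a member for every `θ > 1` and every twist, with non-zero wall value. [cite: Zhang2022LandauSiegel, §7 Prop 7.1 (7.2)] -/
theorem kblen_S1 {θ : ℝ} (hθ : 1 < θ) (k : ℝ) : KBlen (member_S1 θ k) ∧ kappaP θ k 1 ≠ 0 :=
  ⟨kinkedProfile_kappaP_long hθ, kappaP_one_ne_zero hθ⟩

/-- The nine printed lengths (any of the three twists `k ∈ {3/2, 5/2, 7/2}`, indeed any `k`).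
[cite: Zhang2022LandauSiegel, (2.23)–(2.25); §7 Prop 7.1 (7.2)] -/
theorem kblen_S1_grid (k : ℝ) :
    KBlen (member_S1 (101 / 100) k) ∧ KBlen (member_S1 (51 / 50) k) ∧ KBlen (member_S1 (21 / 20) k) ∧
      KBlen (member_S1 (11 / 10) k) ∧ KBlen (member_S1 (6 / 5) k) ∧ KBlen (member_S1 (13 / 10) k) ∧
      KBlen (member_S1 (3 / 2) k) ∧ KBlen (member_S1 (17 / 10) k) ∧ KBlen (member_S1 2 k) :=
  ⟨(kblen_S1 (by norm_num) k).1, (kblen_S1 (by norm_num) k).1, (kblen_S1 (by norm_num) k).1,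
    (kblen_S1 (by norm_num) k).1, (kblen_S1 (by norm_num) k).1, (kblen_S1 (by norm_num) k).1,
    (kblen_S1 (by norm_num) k).1, (kblen_S1 (by norm_num) k).1, (kblen_S1 (by norm_num) k).1⟩

/-! ### Part 2 — S2: smooth two-piece members (30 rows) -/

/-- **`len-S2-kappa1kk+phi-thθ`**: `ϰ(1,k) ⊕ φ_θ` with free scalar `s`. [cite: Zhang2022LandauSiegel, §7 (7.2)] -/
def member_S2kappa (k θ : ℝ) (s : ℂ) : BlenDesign := .s2 θ (kappaP 1 k) (kappaP' 1 k) (phiT θ) (phiT' θ) s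

/-- … is a member (`1 ≤ θ`). [cite: Zhang2022LandauSiegel, §7 Prop 7.1 (7.2)] -/
theorem kblen_S2kappa (k : ℝ) {θ : ℝ} (hθ : 1 ≤ θ) (s : ℂ) : KBlen (member_S2kappa k θ s) :=
  ⟨hθ, inClassPiece_kappaP_one k, overhangPiece_phiT hθ⟩

/-- **`len-S2-hat+phi-thθ`**: `hat ⊕ φ_θ`. [cite: Zhang2022LandauSiegel, §7 (7.2)] -/
def member_S2hat (θ : ℝ) (s : ℂ) : BlenDesign := .s2 θ hatP hatP' (phiT θ) (phiT' θ) s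

/-- … is a member (`1 ≤ θ`). [cite: Zhang2022LandauSiegel, §7 Prop 7.1 (7.2)] -/
theorem kblen_S2hat {θ : ℝ} (hθ : 1 ≤ θ) (s : ℂ) : KBlen (member_S2hat θ s) :=
  ⟨hθ, inClassPiece_hatP, overhangPiece_phiT hθ⟩

/-- **`len-S2-kappa1kk+phitwk′-thθ`**: `ϰ(1,k) ⊕ φ_θ e^{iπk′(θ−z)}`. [cite: Zhang2022LandauSiegel, §7 (7.2)] -/
def member_S2kappaTw (k k' θ : ℝ) (s : ℂ) : BlenDesign :=
  .s2 θ (kappaP 1 k) (kappaP' 1 k) (phiTw θ k') (phiTw' θ k') s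

/-- … is a member (`1 ≤ θ`). [cite: Zhang2022LandauSiegel, §7 Prop 7.1 (7.2)] -/
theorem kblen_S2kappaTw (k k' : ℝ) {θ : ℝ} (hθ : 1 ≤ θ) (s : ℂ) : KBlen (member_S2kappaTw k k' θ s) :=
  ⟨hθ, inClassPiece_kappaP_one k, overhangPiece_phiTw hθ k'⟩

/-- **`len-S2-hat+phitwk′-thθ`**: `hat ⊕ φ_θ e^{iπk′(θ−z)}`. [cite: Zhang2022LandauSiegel, §7 (7.2)] -/
def member_S2hatTw (k' θ : ℝ) (s : ℂ) : BlenDesign := .s2 θ hatP hatP' (phiTw θ k') (phiTw' θ k') s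

/-- … is a member (`1 ≤ θ`). [cite: Zhang2022LandauSiegel, §7 Prop 7.1 (7.2)] -/
theorem kblen_S2hatTw (k' : ℝ) {θ : ℝ} (hθ : 1 ≤ θ) (s : ℂ) : KBlen (member_S2hatTw k' θ s) :=
  ⟨hθ, inClassPiece_hatP, overhangPiece_phiTw hθ k'⟩

/-- The five printed lengths `θ ∈ {21/20, 11/10, 5/4, 3/2, 2}` for the four S2 shapes at `k = 5/2` resp. `3/2`,
twist `5/2`. [cite: Zhang2022LandauSiegel, §7 Prop 7.1 (7.2)] -/
theorem kblen_S2_grid (s : ℂ) :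
    (∀ θ ∈ ({21 / 20, 11 / 10, 5 / 4, 3 / 2, 2} : Set ℝ),
      KBlen (member_S2kappa (5 / 2) θ s) ∧ KBlen (member_S2kappa (3 / 2) θ s) ∧ KBlen (member_S2hat θ s) ∧
        KBlen (member_S2kappaTw (5 / 2) (5 / 2) θ s) ∧ KBlen (member_S2kappaTw (3 / 2) (5 / 2) θ s) ∧
        KBlen (member_S2hatTw (5 / 2) θ s)) := by
  intro θ hθ
  have h1 : 1 ≤ θ := by
    simp only [Set.mem_insert_iff, Set.mem_singleton_iff] at hθ
    rcases hθ with rfl | rfl | rfl | rfl | rfl <;> norm_num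
  exact ⟨kblen_S2kappa _ h1 s, kblen_S2kappa _ h1 s, kblen_S2hat h1 s, kblen_S2kappaTw _ _ h1 s,
    kblen_S2kappaTw _ _ h1 s, kblen_S2hatTw _ h1 s⟩

/-! ### Part 3 — S3: sharp top, wall jump, flat overhang, far pieces -/

/-- **`len-S3a-sharptop-thθ`**: `ϰ(1,5/2) ⊕ (z−1)e^{iπ(5/2)(θ−z)}𝟙_{[1,θ)}` (far BV feature: sharp top at `θ`).
[cite: Zhang2022LandauSiegel, §7 (7.2)] -/
def member_S3a (θ : ℝ) (s : ℂ) : BlenDesign :=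
  .s2rough θ (kappaP 1 (5 / 2)) (kappaP' 1 (5 / 2)) (sharpRamp θ (5 / 2)) (sharpRamp' θ (5 / 2)) s

/-- … is a member (`1 ≤ θ`). [cite: Zhang2022LandauSiegel, §7 Prop 7.1 (7.2)] -/
theorem kblen_S3a {θ : ℝ} (hθ : 1 ≤ θ) (s : ℂ) : KBlen (member_S3a θ s) :=
  ⟨hθ, inClassPiece_kappaP_one _, roughOverhangPiece_sharpRamp θ _⟩

/-- **`len-S3b-walljump-thθ`**: `ϰ(θ,5/2)∣[0,1]` with the wall jump `ϰ(1) → ϰ(1)/2` read as band datum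
`flat (ϰ_{θ,5/2}(1)/2)` (the `O(1)`-scale half continuation beyond the band is far = THEOREM E-033).
[cite: Zhang2022LandauSiegel, §2 (2.30); §7 (7.2)] -/
def member_S3b (θ : ℝ) : BlenDesign :=
  .s1wall (kappaP θ (5 / 2)) (kappaP' θ (5 / 2)) (WallData.flat (kappaP θ (5 / 2) 1 / 2))

/-- … is a member (`1 < θ`; `kblen_wallJump` shape). [cite: Zhang2022LandauSiegel, §7 Prop 7.1 (7.2)] -/
theorem kblen_S3b {θ : ℝ} (hθ : 1 < θ) : KBlen (member_S3b θ) := kinkedProfile_kappaP_long hθ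

/-- **`len-S3c-flat-thθ`** (overhang reading): `ϰ(1,5/2) ⊕ e^{iπ(5/2)(θ−z)}𝟙_{[1,θ)}`.
[cite: Zhang2022LandauSiegel, §7 (7.2)] -/
def member_S3c (θ : ℝ) (s : ℂ) : BlenDesign :=
  .s2rough θ (kappaP 1 (5 / 2)) (kappaP' 1 (5 / 2)) (twistPlateau θ (5 / 2)) (twistPlateau' θ (5 / 2)) s

/-- … is a member (`1 ≤ θ`). [cite: Zhang2022LandauSiegel, §7 Prop 7.1 (7.2)] -/
theorem kblen_S3c {θ : ℝ} (hθ : 1 ≤ θ) (s : ℂ) : KBlen (member_S3c θ s) :=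
  ⟨hθ, inClassPiece_kappaP_one _, roughOverhangPiece_twistPlateau θ _⟩

/-- **`len-S3c-flat-thθ`** (band reading, balanced): `ϰ(1,5/2)` (`u(1) = 0`) with a flat band of height `1` —
the S3c «flat overhang from a zero wall value» of `kblen_wallJump`. [cite: Zhang2022LandauSiegel, §2 (2.30)] -/
def member_S3cWall : BlenDesign := .s1wall (kappaP 1 (5 / 2)) (kappaP' 1 (5 / 2)) (WallData.flat 1)

/-- … is a member. [cite: Zhang2022LandauSiegel, §7 Prop 7.1 (7.2)] -/
theorem kblen_S3cWall : KBlen member_S3cWall := kinkedProfile_kappaP (by norm_num) le_rfl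

/-- The four printed lengths `θ ∈ {21/20, 11/10, 3/2, 2}` of the S3 rows. [cite: Zhang2022LandauSiegel, §7 Prop 7.1 (7.2)] -/
theorem kblen_S3_grid (s : ℂ) :
    ∀ θ ∈ ({21 / 20, 11 / 10, 3 / 2, 2} : Set ℝ),
      KBlen (member_S3a θ s) ∧ KBlen (member_S3b θ) ∧ KBlen (member_S3c θ s) := by
  intro θ hθ
  have h1 : 1 < θ := by
    simp only [Set.mem_insert_iff, Set.mem_singleton_iff] at hθ
    rcases hθ with rfl | rfl | rfl | rfl <;> norm_num
  exact ⟨kblen_S3a h1.le s, kblen_S3b h1, kblen_S3c h1.le s⟩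

/-- **S3 far, smooth** (`familyFarPiece`): the zero profile at multi-far-001's lengths (top `P²`, comparison `P^{5/4}`)
— the stratum's trivial literal member (any 1-Lipschitz profile bounded by `1` qualifies). [cite: Zhang2022LandauSiegel, §7 (7.2)] -/
def member_S3far (c' : ℝ) : BlenDesign := .s3far c' 1 (1 / 4) fun _ => 0

/-- … is a member. [cite: Zhang2022LandauSiegel, §7 (7.2)] -/
theorem kblen_S3far (c' : ℝ) : KBlen (member_S3far c') :=
  ⟨by norm_num, by norm_num, (LipschitzWith.const (0:ℂ)).weaken zero_le_one, fun _ => by simp⟩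

/-- **S3 far, bounded variation** (`familyFarBV`): p4's far step `𝟙_{z ≥ 3/2}` and far block `𝟙_{[3/2,2)}` at the
same lengths. [cite: Zhang2022LandauSiegel, §7 (7.2); §8 Lemma 8.1] -/
def member_S3farBV (c' : ℝ) : BlenDesign := .s3farBV ⟨c', 1, 1 / 4, 1, 2, farBlock⟩

/-- … is a member (`inClass_farBlock`), and so is the far step. [cite: Zhang2022LandauSiegel, §7 (7.2); §8 Lemma 8.1] -/
theorem kblen_S3farBV (c' : ℝ) :
    KBlen (member_S3farBV c') ∧ KBlen (.s3farBV ⟨c', 1, 1 / 4, 1, 1, farStep⟩) :=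
  ⟨inClass_farBlock c' (by norm_num) (by norm_num), inClass_farStep c' (by norm_num) (by norm_num)⟩

/-! ### Part 4 — the θ-box and in-print rows -/

/-- The printed `θ₀` as a Theta box. [cite: Zhang2022LandauSiegel, §2 (2.32)–(2.33)] -/
def member_thetaBox : BlenDesign := .thetaBox theta0

/-- … is a member. [cite: Zhang2022LandauSiegel, §2 (2.32)–(2.33)] -/
theorem kblen_thetaBox : KBlen member_thetaBox := admissible_theta0.lengthsInUnit

/-- The printed `θ₀` as an in-print-lengths row. [cite: Zhang2022LandauSiegel, §2 (2.21); §7 (7.15)] -/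
def member_inPrint : BlenDesign := .inPrint theta0

/-- … is a member (`admissibleThetaLen_theta0`). [cite: Zhang2022LandauSiegel, §2 (2.21); §7 (7.15)] -/
theorem kblen_inPrint : KBlen member_inPrint := admissibleThetaLen_theta0

/-! ### Part 5 — verdicts of record (by `familyBlen_decided`; nothing re-proved) -/

/-- Every member above carries the word's verdict. [cite: Zhang2022LandauSiegel, §2 (2.32)–(2.33); §7 Prop 7.1 (7.2)] -/
theorem verdicts_blen {θ : ℝ} (hθ : 1 < θ) (k k' : ℝ) (s : ℂ) (c' : ℝ) :
    VBlen (member_S1 θ k) ∧ VBlen (member_S2kappa k θ s) ∧ VBlen (member_S2hat θ s) ∧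
      VBlen (member_S2kappaTw k k' θ s) ∧ VBlen (member_S2hatTw k' θ s) ∧
      VBlen (member_S3a θ s) ∧ VBlen (member_S3b θ) ∧ VBlen (member_S3c θ s) ∧ VBlen member_S3cWall ∧
      VBlen (member_S3far c') ∧ VBlen (member_S3farBV c') ∧ VBlen member_thetaBox ∧ VBlen member_inPrint :=
  ⟨familyBlen_decided (member_S1 θ k) (kblen_S1 hθ k).1,
    familyBlen_decided (member_S2kappa k θ s) (kblen_S2kappa k hθ.le s),
    familyBlen_decided (member_S2hat θ s) (kblen_S2hat hθ.le s),
    familyBlen_decided (member_S2kappaTw k k' θ s) (kblen_S2kappaTw k k' hθ.le s),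
    familyBlen_decided (member_S2hatTw k' θ s) (kblen_S2hatTw k' hθ.le s),
    familyBlen_decided (member_S3a θ s) (kblen_S3a hθ.le s),
    familyBlen_decided (member_S3b θ) (kblen_S3b hθ),
    familyBlen_decided (member_S3c θ s) (kblen_S3c hθ.le s),
    familyBlen_decided member_S3cWall kblen_S3cWall,
    familyBlen_decided (member_S3far c') (kblen_S3far c'),
    familyBlen_decided (member_S3farBV c') (kblen_S3farBV c').1,
    familyBlen_decided member_thetaBox kblen_thetaBox,
    familyBlen_decided member_inPrint kblen_inPrint⟩

end Repair

end Literature.NumberTheory.LFunctions.Zhang2022
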